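import Summits.SmoothPoincare4.SmoothPoincare4.Theses.InformationMetricHadamard
import Literature.Geometry.GaugeTheory.InstantonEntropy
import Summits.SmoothPoincare4.SmoothPoincare4.Theorems.InformationMetricHadamardAhHadamardFillingUcstReduction
import Summits.SmoothPoincare4.SmoothPoincare4.Theorems.AhHadamardFilling.Negative.SketchLineCircular

/-!
# Line `universal-cover-strips-topology` — skeleton for crux `InformationMetricHadamard.AhHadamardFilling`

(item stmt-SmoothPoincare4-6014, route `InformationMetricHadamard`, rank 2; idea card
`Cruxes/AhHadamardFilling/Ideas/universal-cover-strips-topology.md`, triage r1-1 / r1-2: pass.)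

Crux (fixed, never restated): every homotopy 4-sphere `Σ` carries a Riemannian metric `g` and is the
cross-section of a proper end collar `Φ : Σ × (0,1) → W` of a Cartan–Hadamard 5-manifold `(W, G)`
(complete, simply connected, `sec ≤ 0`) on which `G` is `C⁰`-asymptotic to `c (dλ² + g)/λ²`.

## The line

LEVER (the idea): simple connectivity of the filling is NOT load-bearing. If `(W, G)` is merely
CONNECTED, complete, `sec ≤ 0`, and carries the crux's collar, then `exp_p : ℝ⁵ → W` is the
universal covering (Cartan–Hadamard, tree `HadamardExpCovering.expMap_covering`); a far collar part
`U = Φ(Σ × (0,t))` is open, simply connected up to a simply connected open neighbourhood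
`Φ(Σ × (0,τ))` of its closure, has compact frontier `Φ(Σ × {t})` and NON-compact closure (deep points
are metrically far, tree `C0AhRecognition.Sketch.stub_farCollarIsFar`); its lifts are `|π₁ W|`
pairwise disjoint open subsets of `ℝ⁵`, each with compact frontier and non-compact closure — and
`ℝ⁵`, having ONE END, contains at most one such set. Hence `π₁ W = 1`.

So the crux reduces to a CONNECTED complete `sec ≤ 0` filling with the collar, and the line takes
for it the INTENDED witness of the route, pinned (not an abstract `∃ W`): the collar component of
the charge-one instanton moduli space `M₁(Σ, g)` (`Literature.Geometry.GaugeTheory.AsdModuliSpace g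
Σ.orientation 1`, in the tree as a bare topological carrier with its curvature-density map
`AsdModuliSpace.density`) carrying Hitchin's information metric, i.e. the Fisher–Rao form of the
densities `ρ_[A] = |F_A|²_g` — stub `stub_instantonCollarComponentNpc` below posits the 5-manifold
structure on an abstract `W` together with a continuous injection `j : W → M₁(Σ, g)` and PINS the
metric by `G(v,v) = ∫_Σ (∂_v ρ_{j(·)})² / ρ_{j(x)} dvol_g`; no `π₀ / π₁ / one-end` hypothesis on
`M₁` is asked (the idea's point: Taubes 1984 path-connectedness is round-metric-only, and births of
closed components along paths of conformal classes are not excluded by anything known).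

Reshape r2 (lead a1, 2026-08-16): S1–S3 LANDED (p124275, p124355, p124446) and are imported; the
closure clause and completeness are proved AUTOMATIC from the remaining collar clauses
(`closure_image_far_subset_of_collar`, `isCompact_setOf_edist_le_of_collar`, over any closed
cross-section `N`), so the apex S4 no longer asks for them; the lever is now the unconditional
theorem `simplyConnected_of_connectedCollarFilling`, and the crux follows from S4 through
`ahHadamardFilling_of_connectedCollarFillings` / `ahHadamardFilling_of_instantonCollarComponentNpc`
— all LANDED as `Theorems/InformationMetricHadamardAhHadamardFillingUcstReduction.lean` (p124840) and imported here (r3):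
this file is now the apex stub + a one-line composition.

Registered stubs (r1; S1–S3 landed, S4 reshaped r2):

* `stub_euclideanOneEnd` (S1; M; point-set topology of `ℝ⁵`: the complement of a closed ball is
  connected in dimension `≥ 2`): two disjoint open subsets of `ℝ⁵` with compact frontiers cannot
  both have non-compact closure.
* `stub_coverSheetsSimplyConnected` (S2; M–L; covering-space theory, Hatcher §1.3: lifting
  criterion + uniqueness of lifts, tree `exists_lift_isOpen_range`,
  `simplyConnectedSpace_of_isCoveringMap_of_subsingleton_fiber`): a covering `F : E → Y` of a path
  connected `Y` by a simply connected one-ended `E` is trivial as soon as `Y` contains an open `U`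
  with compact frontier, non-compact closure, and closure inside the open range of an embedded simply
  connected locally path connected `T`.
* `stub_collarSheetData` (S3; L; Riemannian collar geometry WITHOUT simple connectivity or
  convexity — reuses the landed `C0AhRecognition.Sketch.stub_farCollarImmersive` /
  `stub_farCollarIsFar` / `CoreDistanceMorse.stub_farCollarPackage`): the crux's collar clauses give
  such `T = Σ × (0,τ)`, `ι = Φ`, `U = Φ(Σ × (0,t))`.
* `stub_instantonCollarComponentNpc` (S4; XL / open — the HARDEST, SPC4-strength given crux 6015 by
  the tame-witness dichotomy, as the crux itself is): the typed gauge apex described above = informal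
  route item 7336 minus its `π₀ = π₁ = 0` clause + Groisser–Murray Thm 3.1 (completeness, `C⁰` cone
  asymptotics, `c = 128π²/5`) + nondegeneracy (N) + CORE SIGN `sec(g_I) ≤ 0` for SOME conformal
  class.

Proved here (no `sorry` of their own): `simplyConnected_of_connectedFilling` (stated over the
STATEMENTS of S1, S2, S3 as hypotheses + tree Cartan–Hadamard ⇒ the Transfer `C⁻ ⇒ crux` pointwise: a
connected filling with the collar is simply connected; kernel-checked with no `sorry` in its closure)
and `AhHadamardFilling_of` (the crux BY NAME from the four stubs).

## Disproof.lean / Negative lemmas honoured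

No `Disproof.lean` is published for this crux (`ledger crux ls`, 2026-08-16T19:40Z). Landed
Negative lemmas imported and checked against: `Negative.ahHadamardFilling_of_smoothPoincare4`
(SPC4 ⇒ crux), `Negative.tameFillingNoPi1_iff_smoothPoincare4` (the dead line `Sketch`: its abstract
`∃ W` stub X ↔ SPC4). This skeleton has NO abstract `∃ W` stub: S1–S3 are unconditional lemmas of
topology / Riemannian geometry (provable now), and S4's witness is pinned to `M₁(Σ, g)` by the
continuous injection `j` and the Fisher–Rao identity, so the hyperbolic-space witness `W = ℍ⁵` of
`TameFillingOfSmoothPoincare4.lean` does NOT discharge S4 (it would have to be realised as a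
5-parameter family of charge-one instantons on `Σ` with hyperbolic information metric — Hitchin's
theorem, i.e. genuine gauge content).
-/

noncomputable section

-- the prescribed namespace `Summit.<P>.<Sub>.…` duplicates `SmoothPoincare4` (P = Sub)
set_option linter.dupNamespace false

open scoped Manifold ContDiff Topology ENNReal NNReal
open Set Function

namespace Summit.SmoothPoincare4.SmoothPoincare4.Cruxes.AhHadamardFilling.UniversalCoverStripsTopology

open Literature.Topology.FourManifolds (HomotopySphere)
open Literature.Geometry.Lorentzian (PseudoRiemannianMetric)
open Literature.Geometry.GaugeTheory (AsdModuliSpace volMeasure)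

/-! ## Landed pieces of the line (lead a1, 2026-08-16)

* S1 `stub_euclideanOneEnd` — `Theorems/InformationMetricHadamardAhHadamardFillingStubEuclideanOneEnd.lean` (p124275);
* S2 `stub_coverSheetsSimplyConnected` — `…StubCoverSheetsSimplyConnected.lean` (p124355);
* S3 `stub_collarSheetData` — `…StubCollarSheetData.lean` (p124446);
* Reduction — `…UcstReduction.lean` (p124840): `closure_image_far_subset_of_collar`,
  `isCompact_setOf_edist_le_of_collar` (closure clause and completeness automatic),
  `simplyConnected_of_connectedCollarFilling` (the lever, unconditional),
  `ahHadamardFilling_of_connectedCollarFillings` (crux ⇐ connected `sec ≤ 0` filling with a smooth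
  injective co-compact `C⁰`-conical collar), `ahHadamardFilling_of_instantonCollarComponentNpc`
  (crux ⇐ the apex below). -/

/-! ## Stub S4 — the gauge apex: the collar component of `(M₁(Σ,g), g_I)` is a connected complete
`sec ≤ 0` filling with the Donaldson–Taubes–Groisser–Murray collar (HARDEST) -/

/-- **S4 (`instantonCollarComponentNpc`; HARDEST, open; reshape r2: the completeness conjunct AND the
closure clause are DROPPED — both follow from the other collar clauses,
`isCompact_setOf_edist_le_of_collar`, `closure_image_far_subset_of_collar`).** For every homotopy 4-sphere `Σ` there is
a Riemannian metric `g` (a generic representative of SOME conformal class) and a connected smooth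
5-manifold `W` injecting continuously into the charge-one moduli space
`M₁(Σ, g) = AsdModuliSpace g Σ.orientation 1` — intended: `W` = the collar component of `M₁`,
`j` = inclusion — carrying a Riemannian metric `G` which IS Hitchin's information metric of the
curvature densities `ρ_[A] = |F_A|²_g` along `j` (Fisher–Rao identity
`G_x(v,v) = ∫_Σ (d/dt|₀ ρ_{j(γ_{x,v}(t))})² / ρ_{j(x)} dvol_g`, `γ_{x,v}` the chart line), such
that `(W, G)` is complete (closed balls compact: Groisser–Murray 1997 Thm 3.1 + nondegeneracy of
`g_I` on the component + no other end), has `sec ≤ 0` (CORE SIGN — the open content: near infinity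
it follows from `C²` cone asymptotics, osculating-poisson-collar; in the core no mechanism is known
off the round class), and contains the crux's collar `Φ` (Donaldson–Taubes collar; `C⁰` cone
asymptotics = GM Thm 3.1 with `c = 128π²/5`; co-compactness of far parts = one-endedness of the
component, Uhlenbeck compactness at `k = 1`, `H²(Σ) = 0`). NOT asked: `π₁(W) = 1`, connectedness
of `M₁`, absence of closed components (the line's lever makes them moot).
[GroisserMurray1997 Thm 3.1, §2, §5; Hitchin1990; Taubes1982; Donaldson1983; FreedUhlenbeck1984;
Uhlenbeck1982] -/
theorem stub_instantonCollarComponentNpc (S : HomotopySphere 4) [Nonempty S.carrier]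
    [T3Space S.carrier] :
    ∃ (g : PseudoRiemannianMetric (𝓡 4) ∞ (EuclideanSpace ℝ (Fin 4)) (TangentSpace (𝓡 4) : S.carrier → Type _))
      (hg : g.IsRiemannian) (W : Type) (_ : TopologicalSpace W) (_ : T2Space W)
      (_ : SecondCountableTopology W) (_ : ChartedSpace (EuclideanSpace ℝ (Fin 5)) W)
      (_ : IsManifold (𝓡 5) ∞ W) (_ : ConnectedSpace W)
      (G : PseudoRiemannianMetric (𝓡 5) ∞ (EuclideanSpace ℝ (Fin 5)) (TangentSpace (𝓡 5) : W → Type _))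
      (_ : G.IsRiemannian) (j : W → AsdModuliSpace g S.orientation 1) (c : ℝ)
      (Φ : S.carrier × ℝ → W),
      Continuous j ∧ Injective j ∧
      (∀ (x : W) (v : TangentSpace (𝓡 5) x),
        G.val x v v =
          ∫ y, (deriv (fun t : ℝ ↦
              (j ((extChartAt (𝓡 5) x).symm
                (extChartAt (𝓡 5) x x + t • (show EuclideanSpace ℝ (Fin 5) from v)))).density g y) 0) ^ 2 /
            (j x).density g y ∂(volMeasure g hg)) ∧
      0 < c ∧
      (∀ cov, G.IsLeviCivita cov →
        ∀ (x : W) (X Y : TangentSpace (𝓡 5) x), G.sectionalCurvature cov x X Y ≤ 0) ∧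
      ContMDiffOn ((𝓡 4).prod 𝓘(ℝ, ℝ)) (𝓡 5) ∞ Φ (univ ×ˢ Ioo (0 : ℝ) 1) ∧
      InjOn Φ (univ ×ˢ Ioo (0 : ℝ) 1) ∧
      (∀ t ∈ Ioo (0 : ℝ) 1, IsCompact (Φ '' (univ ×ˢ Ioo (0 : ℝ) t))ᶜ) ∧
      (∀ ε : ℝ, 0 < ε → ∃ t ∈ Ioo (0 : ℝ) 1, ∀ (x : S.carrier) (l : ℝ), l ∈ Ioo (0 : ℝ) t →
        ∀ (v : TangentSpace (𝓡 4) x) (s : ℝ),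
          |G.val (Φ (x, l)) (mfderiv ((𝓡 4).prod 𝓘(ℝ, ℝ)) (𝓡 5) Φ (x, l) (v, s))
              (mfderiv ((𝓡 4).prod 𝓘(ℝ, ℝ)) (𝓡 5) Φ (x, l) (v, s)) -
            c * (s ^ 2 + g.val x v v) / l ^ 2| ≤ ε * (c * (s ^ 2 + g.val x v v) / l ^ 2)) := by
  sorry

/-! ## The composition (kernel-checked; no `sorry` of its own) -/

/-- **The line concludes the crux BY NAME** from its one open registered stub, the gauge apex S4
(r2 signature), through the landed sorry-free reduction
`ahHadamardFilling_of_instantonCollarComponentNpc` (p124840). [folklore] -/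
theorem AhHadamardFilling_of :
    Summit.SmoothPoincare4.SmoothPoincare4.Theses.InformationMetricHadamard.AhHadamardFilling :=
  ahHadamardFilling_of_instantonCollarComponentNpc fun S _ _ ↦ stub_instantonCollarComponentNpc S

end Summit.SmoothPoincare4.SmoothPoincare4.Cruxes.AhHadamardFilling.UniversalCoverStripsTopology

end
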